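import Mathlib
import Summits.ResolutionOfSingularities.ResolutionOfSingularities.Theorems.WildQuotientsWildQuotientResolutionLinearPowFourNormalForm
import Summits.ResolutionOfSingularities.ResolutionOfSingularities.Theorems.WildQuotientsWildQuotientResolutionLinearCubeZeroOfJordanThree

/-!
# The LINEAR sector of `CyclicQuotientFourfolds` (stmt-17941), every `p`, modulo the `J₃` and `J₄` finals

Crux stmt-ResolutionOfSingularities-15640 (`WildQuotients.WildQuotientResolution`), line `Sketch`;
chain w45c (res-L1-w45c-stub-3, «JNF-4» row). [OURS · L1 W4.5c] — a REDUCTION, kernel-checked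
modulo two named finals, NOT a statement of the manuscript and NOT a proof of stmt-17941.

* `linearCyclicQuotientFourfold_hasResolution_of_finals` — for a LINEAR `σ` on `k[x₁,…,xₙ]`,
  `n ≤ 4`, with `(σ − 1)⁴ = 0` on the coordinates: `Spec k[x]^⟨σ⟩` has a resolution PROVIDED the
  `J₃` final (programme V3U F1, shape of `LinearCubeZero.linearCyclicQuotient_hasResolution_of_
  cube_zero_of_jordanThree`'s `hJ3`) and the `J₄` final (programme V4U) hold — by JNF-4
  (`LinearPowFour.exists_conj_normalForm_of_pow_four`): LSB data are landed unconditionally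
  (`LinearSmallBlocks.hasResolution`, p471938), conjugation transports
  (`TameTransfer.hasResolution_fixedPoints_zpowers_conj`).
* `linearCyclicQuotientFourfold_hasResolution_of_finals'` — the same with the natural hypothesis
  `σᵖ = 1` (`char k = p`) instead of `(σ − 1)⁴ = 0`: a linear automorphism of order `p` in
  characteristic `p` is unipotent (`(σ − 1)ᵖ = σᵖ − 1 = 0` in `End_k k[x]`), and a nilpotent
  endomorphism of the `n ≤ 4`-dimensional degree-one part has vanishing fourth power
  (Cayley–Hamilton, `IsNilpotent.charpoly_eq_X_pow_finrank`).
So after V3U-F1 and V4U-F the linear `ℤ/p`-quotients `𝔸ⁿ/σ`, `n ≤ 4`, are resolved for EVERY `p`.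
-/

-- single-problem summit: the doubled namespace component `ResolutionOfSingularities` is forced
set_option linter.dupNamespace false

noncomputable section

open Module MvPolynomial AlgebraicGeometry
open Literature.AlgebraicGeometry.Resolution

namespace Summit.ResolutionOfSingularities.ResolutionOfSingularities.Theorems.WildQuotientResolution.LinearPowFour

/-- **The linear sector of stmt-17941 modulo the `J₃` and `J₄` finals** (`(σ − 1)⁴ = 0` form).
[OURS · L1 W4.5c] [folklore; reduction] -/
theorem linearCyclicQuotientFourfold_hasResolution_of_finals (p : ℕ) (hp : p.Prime)
    (k : Type) [Field k] [CharP k p]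
    (hJ3 : ∀ (n : ℕ) (σ : MvPolynomial (Fin n) k ≃ₐ[k] MvPolynomial (Fin n) k) (a b c : Fin n),
      a ≠ b → b ≠ c → a ≠ c → σ (X b) = X b + X a → σ (X c) = X c + X b →
      (∀ i, i ≠ b → i ≠ c → σ (X i) = X i) →
      Scheme.HasResolution
        (Spec (.of (FixedPoints.subalgebra k (MvPolynomial (Fin n) k) (Subgroup.zpowers σ)))))
    (hJ4 : ∀ (n : ℕ) (σ : MvPolynomial (Fin n) k ≃ₐ[k] MvPolynomial (Fin n) k) (a b c d : Fin n),
      a ≠ b → a ≠ c → a ≠ d → b ≠ c → b ≠ d → c ≠ d →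
      σ (X b) = X b + X a → σ (X c) = X c + X b → σ (X d) = X d + X c →
      (∀ i, i ≠ b → i ≠ c → i ≠ d → σ (X i) = X i) →
      Scheme.HasResolution
        (Spec (.of (FixedPoints.subalgebra k (MvPolynomial (Fin n) k) (Subgroup.zpowers σ)))))
    (n : ℕ) (hn : n ≤ 4) (σ : MvPolynomial (Fin n) k ≃ₐ[k] MvPolynomial (Fin n) k)
    (hlin : ∀ i, σ (X i) ∈ Submodule.span k (Set.range (X : Fin n → MvPolynomial (Fin n) k)))
    (hfour : ∀ i,
      σ (σ (σ (σ (X i) - X i) - (σ (X i) - X i)) - (σ (σ (X i) - X i) - (σ (X i) - X i))) =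
        σ (σ (σ (X i) - X i) - (σ (X i) - X i)) - (σ (σ (X i) - X i) - (σ (X i) - X i))) :
    Scheme.HasResolution
      (Spec (.of (FixedPoints.subalgebra k (MvPolynomial (Fin n) k) (Subgroup.zpowers σ)))) := by
  obtain ⟨τ, h⟩ := exists_conj_normalForm_of_pow_four k n hn σ hlin hfour
  have e : τ⁻¹ * (τ * σ * τ⁻¹) * τ⁻¹⁻¹ = σ := by group
  rcases h with ⟨D, f, hfD, hD, hoff⟩ | ⟨a, b, c, hab, hbc, hac, hb, hc, hrest⟩ |
    ⟨a, b, c, d, hab, hac, had, hbc, hbd, hcd, hb, hc, hd, hrest⟩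
  · have h := LinearSmallBlocks.hasResolution p hp k n (τ * σ * τ⁻¹) D f hfD hD hoff
    have h' := TameTransfer.hasResolution_fixedPoints_zpowers_conj (τ * σ * τ⁻¹) τ⁻¹ h
    rw [e] at h'
    exact h'
  · have h := hJ3 n (τ * σ * τ⁻¹) a b c hab hbc hac hb hc hrest
    have h' := TameTransfer.hasResolution_fixedPoints_zpowers_conj (τ * σ * τ⁻¹) τ⁻¹ h
    rw [e] at h'
    exact h'
  · have h := hJ4 n (τ * σ * τ⁻¹) a b c d hab hac had hbc hbd hcd hb hc hd hrest
    have h' := TameTransfer.hasResolution_fixedPoints_zpowers_conj (τ * σ * τ⁻¹) τ⁻¹ h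
    rw [e] at h'
    exact h'

/-- **A linear automorphism of order `p` in characteristic `p` on `≤ 4` variables satisfies
`(σ − 1)⁴ = 0` on the coordinates.** (`(σ − 1)ᵖ = σᵖ − 1 = 0` in `End_k k[x]`; restricted to the
`σ`-stable degree-one part `L` (`dim L = n ≤ 4`) the nilpotent `σ − 1` has `charpoly = Xⁿ`, so
`(σ − 1)ⁿ = 0` by Cayley–Hamilton, hence `(σ − 1)⁴ = 0` on `L`.) [folklore] -/
theorem pow_four_of_pow_char (p : ℕ) (hp : p.Prime) (k : Type) [Field k] [CharP k p] (n : ℕ)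
    (hn : n ≤ 4) (σ : MvPolynomial (Fin n) k ≃ₐ[k] MvPolynomial (Fin n) k)
    (hlin : ∀ i, σ (X i) ∈ Submodule.span k (Set.range (X : Fin n → MvPolynomial (Fin n) k)))
    (hσp : ∀ i, (σ ^ p) (X i) = X i) (i : Fin n) :
    σ (σ (σ (σ (X i) - X i) - (σ (X i) - X i)) - (σ (σ (X i) - X i) - (σ (X i) - X i))) =
      σ (σ (σ (X i) - X i) - (σ (X i) - X i)) - (σ (σ (X i) - X i) - (σ (X i) - X i)) := by
  classical
  haveI : Fact p.Prime := ⟨hp⟩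
  -- the degree-one part and `N = σ − 1` on it
  let L := Submodule.span k (Set.range (X : Fin n → MvPolynomial (Fin n) k))
  have hX : LinearIndependent k (X : Fin n → MvPolynomial (Fin n) k) :=
    MvPolynomial.linearIndependent_X _ _
  let bX : Basis (Fin n) k L := Basis.span hX
  haveI : FiniteDimensional k L := Module.Finite.of_basis bX
  have hrank : Module.finrank k L = n := by
    rw [Module.finrank_eq_card_basis bX, Fintype.card_fin]
  have hσL : ∀ x ∈ L, σ.toLinearMap x ∈ L := by
    intro x hx
    have h : Submodule.map σ.toLinearMap L ≤ L := by
      change Submodule.map σ.toLinearMap (Submodule.span k _) ≤ L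
      rw [Submodule.map_span_le]
      rintro _ ⟨j, rfl⟩
      exact hlin j
    exact h ⟨x, hx, rfl⟩
  let S : L →ₗ[k] L := σ.toLinearMap.restrict hσL
  let N : L →ₗ[k] L := S - 1
  have hNval : ∀ x : L, ((N x : L) : MvPolynomial (Fin n) k) = σ x - x := fun x => rfl
  have hbX : ∀ j, ((bX j : L) : MvPolynomial (Fin n) k) = X j :=
    fun j => congrArg Subtype.val (Basis.span_apply hX j)
  -- `Sᵐ x = σᵐ x`
  have hSpow : ∀ (m : ℕ) (x : L), (((S ^ m) x : L) : MvPolynomial (Fin n) k) = (σ ^ m) x := by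
    intro m
    induction m with
    | zero => intro x; simp
    | succ m ih =>
      intro x
      rw [pow_succ', pow_succ', Module.End.mul_apply, AlgEquiv.mul_apply, ← ih x]
      rfl
  -- `Sᵖ = 1` (checked on the basis `X j`)
  have hSp : S ^ p = 1 :=
    bX.ext fun j => Subtype.ext (by rw [hSpow, Module.End.one_apply, hbX, hσp j])
  -- `L ≠ 0` (we are proving a statement about `X i`, so `n ≥ 1`) and `char End_k L = p`
  haveI : Nontrivial L := nontrivial_of_ne (bX i) 0 (bX.ne_zero i)
  haveI : CharP (Module.End k L) p :=
    charP_of_injective_algebraMap (algebraMap k (Module.End k L)).injective p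
  -- `N = S − 1` is nilpotent: `Nᵖ = Sᵖ − 1 = 0`
  have hNp : N ^ p = 0 := by
    change (S - 1) ^ p = 0
    rw [sub_pow_char_of_commute (R := Module.End k L) (p := p) (Commute.one_right S), hSp, one_pow,
      sub_self]
  have hnil : IsNilpotent N := ⟨p, hNp⟩
  -- Cayley–Hamilton: `Nⁿ = 0`, hence `N⁴ = 0`
  have hNn : N ^ n = 0 := by
    have h := LinearMap.aeval_self_charpoly N
    rwa [hnil.charpoly_eq_X_pow_finrank, Polynomial.aeval_X_pow, hrank] at h
  have hN4 : N ^ 4 = 0 := pow_eq_zero_of_le hn hNn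
  have h4 : N (N (N (N (bX i)))) = 0 := by
    have h := congrArg (fun g : L →ₗ[k] L => g (bX i)) hN4
    simpa only [pow_succ, Module.End.mul_apply, LinearMap.zero_apply, pow_zero,
      Module.End.one_apply] using h
  have h' := congrArg Subtype.val h4
  rw [hNval, hNval, hNval, hNval, hbX, Submodule.coe_zero] at h'
  exact sub_eq_zero.1 h'

/-- **The linear sector of stmt-17941 modulo the `J₃` and `J₄` finals** (`σᵖ = 1` form): every
LINEAR automorphism `σ` of `k[x₁,…,xₙ]`, `n ≤ 4`, with `σᵖ = 1` on the coordinates, `char k = p`,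
has `Spec k[x]^⟨σ⟩` resolvable provided the `J₃` and `J₄` finals hold.
[OURS · L1 W4.5c] [folklore; reduction] -/
theorem linearCyclicQuotientFourfold_hasResolution_of_finals' (p : ℕ) (hp : p.Prime)
    (k : Type) [Field k] [CharP k p]
    (hJ3 : ∀ (n : ℕ) (σ : MvPolynomial (Fin n) k ≃ₐ[k] MvPolynomial (Fin n) k) (a b c : Fin n),
      a ≠ b → b ≠ c → a ≠ c → σ (X b) = X b + X a → σ (X c) = X c + X b →
      (∀ i, i ≠ b → i ≠ c → σ (X i) = X i) →
      Scheme.HasResolution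
        (Spec (.of (FixedPoints.subalgebra k (MvPolynomial (Fin n) k) (Subgroup.zpowers σ)))))
    (hJ4 : ∀ (n : ℕ) (σ : MvPolynomial (Fin n) k ≃ₐ[k] MvPolynomial (Fin n) k) (a b c d : Fin n),
      a ≠ b → a ≠ c → a ≠ d → b ≠ c → b ≠ d → c ≠ d →
      σ (X b) = X b + X a → σ (X c) = X c + X b → σ (X d) = X d + X c →
      (∀ i, i ≠ b → i ≠ c → i ≠ d → σ (X i) = X i) →
      Scheme.HasResolution
        (Spec (.of (FixedPoints.subalgebra k (MvPolynomial (Fin n) k) (Subgroup.zpowers σ)))))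
    (n : ℕ) (hn : n ≤ 4) (σ : MvPolynomial (Fin n) k ≃ₐ[k] MvPolynomial (Fin n) k)
    (hlin : ∀ i, σ (X i) ∈ Submodule.span k (Set.range (X : Fin n → MvPolynomial (Fin n) k)))
    (hσp : ∀ i, (σ ^ p) (X i) = X i) :
    Scheme.HasResolution
      (Spec (.of (FixedPoints.subalgebra k (MvPolynomial (Fin n) k) (Subgroup.zpowers σ)))) :=
  linearCyclicQuotientFourfold_hasResolution_of_finals p hp k hJ3 hJ4 n hn σ hlin
    (pow_four_of_pow_char p hp k n hn σ hlin hσp)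

end Summit.ResolutionOfSingularities.ResolutionOfSingularities.Theorems.WildQuotientResolution.LinearPowFour

end
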